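import Literature.NumberTheory.Automorphic.ResiduallyUnipotentFixedCosetCount   -- ★ p845609 (this seat): `ncard_fixedBy_glInt_rank_eq_ncard_free`, `ncard_fixedBy_unitary_rank_eq_ncard_free`
import HarnessLib

/-!
# For a DEEP `γ` the cyclic lattice `⊕_{j<n} 𝒪·γ^j w` is automatically `γ`-stable; the regular-unipotent stratum counts without the stability conjunct

Topic `NumberTheory/Automorphic`; namespace `Literature.NumberTheory.Automorphic`.  THEOREMS ONLY (no definition, no instance, no notation, no named fact,
no `sorry`); generic `[Field F] [ValuativeRel F]`, any `n`.  Cell `pub/hodgecm-mathlib` (D-0151), crux H413 = `stmt-HodgeConjecture-24833`; road «S3-tree»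
(architect A-p16 (g29) A-65 (1)), brick T3′ (holder F0P3b-p01 (g11)), organ O8b rider (A-p12 (g21); holder «=» 16:40:46Z (2); ref5 R-18 (iv)): the seam to
O8a-4 «COUNT TRANSPORT» (`SplitTorusOrderCountTransport`), whose LEFT set is the CONJUNCT-FREE `{Λ = Λ(u), u ∈ U : ∃ w, Λ = ⊕ 𝒪·τ^j w}`.  HONEST LABEL: HC_CM is
proved only modulo the 2 remaining named inputs (hLiu418 24832, h413 24833) until rung 0 closes; nothing printed is asserted here.

THE MATHEMATICS.  If `p_γ ≡ (X − 1)^n (mod 𝔪)` coefficientwise then `p_γ ∈ 𝒪[X]` (§1) and `|p_γ(0)| = 1`.  Cayley–Hamilton gives `γ^n w = −Σ_{j<n} c_j γ^j w ∈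
Λ := ⊕_{j<n} 𝒪·γ^j w`, so `γΛ ⊆ Λ`; and `γ · (−c₀⁻¹ (p_γ∕X)(γ)) = 1` with `−c₀⁻¹ (p_γ∕X)(γ) ∈ 𝒪[γ]`, so `Λ ⊆ γΛ` (§2).  Hence the conjunct `γΛ = Λ` in ★
`ncard_fixedBy_glInt_rank_eq_ncard_free` ∕ ★ `ncard_fixedBy_unitary_rank_eq_ncard_free` can be dropped (§3).

* §1 `charpoly_coeff_mem_integer_of_deep`, `valuation_charpoly_coeff_zero_eq_one_of_deep`.
* §2 **`map_span_range_pow_mulVec_eq_self_of_deep`**.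
* §3 **`ncard_fixedBy_glInt_rank_eq_ncard_free'`**, **`ncard_fixedBy_unitary_rank_eq_ncard_free'`**.

## References
* [Kottwitz1986] R. E. Kottwitz, *Base change for unit elements of Hecke algebras*, Compositio Math. 60 (1986): §3.
* [HornJohnson2013] R. A. Horn, C. R. Johnson, *Matrix Analysis*, 2nd ed. (CUP 2013): Thm 2.4.3.2 (Cayley–Hamilton) p. 109.
* [Rogawski1990] J. D. Rogawski, *Automorphic Representations of Unitary Groups in Three Variables* (1990): §4.9 p. 54, Prop. 4.9.1 (b) p. 55.
-/

set_option autoImplicit false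

noncomputable section

open scoped ValuativeRel Matrix MatrixGroups Polynomial
open ValuativeRel Set

namespace Literature.NumberTheory.Automorphic

open Literature.NumberTheory.Automorphic.IntegralReduction

/-! ## §1 Integrality of `p_γ` and `|p_γ(0)| = 1` for a deep `γ`; §2 stability; §3 the conjunct-free counts -/

section Stable

variable {F : Type*} [Field F] [ValuativeRel F] {n : ℕ}

/-- A deep `γ` (`p_γ ≡ (X − 1)^n mod 𝔪` coefficientwise) has INTEGRAL characteristic polynomial. [cite: Kottwitz1986, §3] -/
theorem charpoly_coeff_mem_integer_of_deep (γ : GL (Fin n) F)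
    (hγ : ∀ m : ℕ, valuation F (((γ : Matrix (Fin n) (Fin n) F).charpoly - (Polynomial.X - 1) ^ n).coeff m) < 1) (m : ℕ) :
    (γ : Matrix (Fin n) (Fin n) F).charpoly.coeff m ∈ 𝒪[F] := by
  have h1 : ((Polynomial.X - 1 : Polynomial F) ^ n).coeff m ∈ 𝒪[F] := by
    have h : ((Polynomial.X - 1 : Polynomial F) ^ n) = Polynomial.map (Int.castRingHom F) ((Polynomial.X - 1) ^ n) := by
      rw [Polynomial.map_pow, Polynomial.map_sub, Polynomial.map_X, Polynomial.map_one]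
    rw [h, Polynomial.coeff_map, Int.coe_castRingHom]
    exact intCast_mem _ _
  have h2 : ((γ : Matrix (Fin n) (Fin n) F).charpoly - (Polynomial.X - 1) ^ n).coeff m ∈ 𝒪[F] :=
    (Valuation.mem_integer_iff _ _).2 (hγ m).le
  have h3 : (γ : Matrix (Fin n) (Fin n) F).charpoly.coeff m =
      ((γ : Matrix (Fin n) (Fin n) F).charpoly - (Polynomial.X - 1) ^ n).coeff m + ((Polynomial.X - 1 : Polynomial F) ^ n).coeff m := by
    rw [Polynomial.coeff_sub, sub_add_cancel]
  rw [h3]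
  exact add_mem h2 h1

/-- A deep `γ` has `|p_γ(0)| = 1` (so `|det γ| = 1` and `γ⁻¹ ∈ 𝒪[γ]`). [cite: Kottwitz1986, §3] -/
theorem valuation_charpoly_coeff_zero_eq_one_of_deep (γ : GL (Fin n) F)
    (hγ : ∀ m : ℕ, valuation F (((γ : Matrix (Fin n) (Fin n) F).charpoly - (Polynomial.X - 1) ^ n).coeff m) < 1) :
    valuation F ((γ : Matrix (Fin n) (Fin n) F).charpoly.coeff 0) = 1 := by
  have h0 : ((Polynomial.X - 1 : Polynomial F) ^ n).coeff 0 = (-1) ^ n := by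
    rw [Polynomial.coeff_zero_eq_eval_zero, Polynomial.eval_pow, Polynomial.eval_sub, Polynomial.eval_X, Polynomial.eval_one, zero_sub]
  have h1 : valuation F ((-1 : F) ^ n) = 1 := by rw [map_pow, Valuation.map_neg, map_one, one_pow]
  have h := hγ 0
  rw [Polynomial.coeff_sub, h0, ← h1] at h
  rw [← add_sub_cancel ((-1 : F) ^ n) ((γ : Matrix (Fin n) (Fin n) F).charpoly.coeff 0), Valuation.map_add_eq_of_lt_left _ h, h1]

/-- **FOR A DEEP `γ` THE CYCLIC LATTICE `⊕_{j<n} 𝒪·γ^j w` IS `γ`-STABLE** (Cayley–Hamilton with integral coefficients: `γ^n w ∈ ⊕ 𝒪·γ^j w`, and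
`γ⁻¹ = −p_γ(0)⁻¹·(p_γ ∕ X)(γ) ∈ 𝒪[γ]` since `|p_γ(0)| = 1`), so the conjunct `γΛ = Λ` in ★ `ncard_fixedBy_glInt_rank_eq_ncard_free` ∕ ★
`ncard_fixedBy_unitary_rank_eq_ncard_free` is automatic. [cite: Kottwitz1986, §3] [cite: HornJohnson2013, Thm 2.4.3.2 (Cayley–Hamilton) p. 109] -/
theorem map_span_range_pow_mulVec_eq_self_of_deep (γ : GL (Fin n) F)
    (hγ : ∀ m : ℕ, valuation F (((γ : Matrix (Fin n) (Fin n) F).charpoly - (Polynomial.X - 1) ^ n).coeff m) < 1) (w : Fin n → F) :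
    (Submodule.span 𝒪[F] (Set.range fun j : Fin n => ((γ : Matrix (Fin n) (Fin n) F) ^ (j : ℕ)) *ᵥ w)).map
        ((Matrix.toLin' (γ : Matrix (Fin n) (Fin n) F)).restrictScalars 𝒪[F]) =
      Submodule.span 𝒪[F] (Set.range fun j : Fin n => ((γ : Matrix (Fin n) (Fin n) F) ^ (j : ℕ)) *ᵥ w) := by
  have hint := charpoly_coeff_mem_integer_of_deep γ hγ
  have hdeg : (γ : Matrix (Fin n) (Fin n) F).charpoly.natDegree = n := by rw [Matrix.charpoly_natDegree_eq_dim, Fintype.card_fin]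
  have hmonic : (γ : Matrix (Fin n) (Fin n) F).charpoly.coeff n = 1 := by
    have h := (Matrix.charpoly_monic (γ : Matrix (Fin n) (Fin n) F)).coeff_natDegree
    rwa [hdeg] at h
  -- the `𝒪`-action is the restriction of the `F`-action
  have hsmul : ∀ (c : F), c ∈ 𝒪[F] → ∀ x ∈ Submodule.span 𝒪[F] (Set.range fun j : Fin n => ((γ : Matrix (Fin n) (Fin n) F) ^ (j : ℕ)) *ᵥ w),
      c • x ∈ Submodule.span 𝒪[F] (Set.range fun j : Fin n => ((γ : Matrix (Fin n) (Fin n) F) ^ (j : ℕ)) *ᵥ w) :=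
    fun c hc x hx => Submodule.smul_mem _ (⟨c, hc⟩ : 𝒪[F]) hx
  -- (a) Cayley–Hamilton: `γ^n w ∈ ⊕ 𝒪·γ^j w`
  have hCH : (γ : Matrix (Fin n) (Fin n) F) ^ n = -∑ i ∈ Finset.range n, (γ : Matrix (Fin n) (Fin n) F).charpoly.coeff i • (γ : Matrix (Fin n) (Fin n) F) ^ i := by
    have h := Matrix.aeval_self_charpoly (γ : Matrix (Fin n) (Fin n) F)
    rw [Polynomial.aeval_eq_sum_range, hdeg, Finset.sum_range_succ, hmonic, one_smul] at h
    exact eq_neg_of_add_eq_zero_right h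
  have hn_mem : ((γ : Matrix (Fin n) (Fin n) F) ^ n) *ᵥ w ∈ Submodule.span 𝒪[F] (Set.range fun j : Fin n => ((γ : Matrix (Fin n) (Fin n) F) ^ (j : ℕ)) *ᵥ w) := by
    rw [hCH, Matrix.neg_mulVec, Matrix.sum_mulVec]
    refine Submodule.neg_mem _ (Submodule.sum_mem _ fun i hi => ?_)
    rw [Matrix.smul_mulVec]
    exact hsmul _ (hint i) _ (Submodule.subset_span ⟨⟨i, Finset.mem_range.1 hi⟩, rfl⟩)
  -- (b) `γ · (⊕ 𝒪·γ^j w) ≤ ⊕ 𝒪·γ^j w`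
  have hle : (Submodule.span 𝒪[F] (Set.range fun j : Fin n => ((γ : Matrix (Fin n) (Fin n) F) ^ (j : ℕ)) *ᵥ w)).map
      ((Matrix.toLin' (γ : Matrix (Fin n) (Fin n) F)).restrictScalars 𝒪[F]) ≤
        Submodule.span 𝒪[F] (Set.range fun j : Fin n => ((γ : Matrix (Fin n) (Fin n) F) ^ (j : ℕ)) *ᵥ w) := by
    rw [Submodule.map_le_iff_le_comap, Submodule.span_le]
    rintro _ ⟨j, rfl⟩
    rw [SetLike.mem_coe, Submodule.mem_comap, LinearMap.coe_restrictScalars, Matrix.toLin'_apply, Matrix.mulVec_mulVec, ← pow_succ']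
    by_cases hj : (j : ℕ) + 1 < n
    · exact Submodule.subset_span ⟨⟨(j : ℕ) + 1, hj⟩, rfl⟩
    · have hjn : (j : ℕ) + 1 = n := by have := j.2; omega
      rw [hjn]
      exact hn_mem
  -- (c) every power `γ^k w` lies in the lattice
  have hpow : ∀ k : ℕ, ((γ : Matrix (Fin n) (Fin n) F) ^ k) *ᵥ w ∈ Submodule.span 𝒪[F] (Set.range fun j : Fin n => ((γ : Matrix (Fin n) (Fin n) F) ^ (j : ℕ)) *ᵥ w) := by
    intro k
    induction k with
    | zero =>
      rcases Nat.eq_zero_or_pos n with h0 | h0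
      · subst h0
        have hw : w = 0 := funext fun i => Fin.elim0 i
        rw [hw, Matrix.mulVec_zero]
        exact Submodule.zero_mem _
      · exact Submodule.subset_span ⟨⟨0, h0⟩, rfl⟩
    | succ k ih =>
      rw [pow_succ', ← Matrix.mulVec_mulVec]
      exact hle ⟨_, ih, rfl⟩
  -- (d) `γ⁻¹ = −p(0)⁻¹ · (p ∕ X)(γ)`, so `⊕ 𝒪·γ^j w ≤ γ · (⊕ 𝒪·γ^j w)`
  have hc0 := valuation_charpoly_coeff_zero_eq_one_of_deep γ hγ
  have hc0ne : (γ : Matrix (Fin n) (Fin n) F).charpoly.coeff 0 ≠ 0 := fun h => by rw [h, map_zero] at hc0; exact zero_ne_one hc0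
  have hγB : (γ : Matrix (Fin n) (Fin n) F) * (-((γ : Matrix (Fin n) (Fin n) F).charpoly.coeff 0)⁻¹ •
      Polynomial.aeval (γ : Matrix (Fin n) (Fin n) F) (γ : Matrix (Fin n) (Fin n) F).charpoly.divX) = 1 := by
    have h := Matrix.aeval_self_charpoly (γ : Matrix (Fin n) (Fin n) F)
    conv_lhs at h => rw [← Polynomial.X_mul_divX_add (γ : Matrix (Fin n) (Fin n) F).charpoly]
    rw [map_add, map_mul, Polynomial.aeval_X, Polynomial.aeval_C, Algebra.algebraMap_eq_smul_one, add_eq_zero_iff_eq_neg] at h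
    rw [Matrix.mul_smul, h, smul_neg, neg_smul, neg_neg, smul_smul, inv_mul_cancel₀ hc0ne, one_smul]
  have hge : Submodule.span 𝒪[F] (Set.range fun j : Fin n => ((γ : Matrix (Fin n) (Fin n) F) ^ (j : ℕ)) *ᵥ w) ≤
      (Submodule.span 𝒪[F] (Set.range fun j : Fin n => ((γ : Matrix (Fin n) (Fin n) F) ^ (j : ℕ)) *ᵥ w)).map
        ((Matrix.toLin' (γ : Matrix (Fin n) (Fin n) F)).restrictScalars 𝒪[F]) := by
    rw [Submodule.span_le]
    rintro _ ⟨j, rfl⟩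
    refine ⟨(-((γ : Matrix (Fin n) (Fin n) F).charpoly.coeff 0)⁻¹ • Polynomial.aeval (γ : Matrix (Fin n) (Fin n) F) (γ : Matrix (Fin n) (Fin n) F).charpoly.divX) *ᵥ
      (((γ : Matrix (Fin n) (Fin n) F) ^ (j : ℕ)) *ᵥ w), ?_, ?_⟩
    · rw [SetLike.mem_coe, Matrix.smul_mulVec, Polynomial.aeval_eq_sum_range, Matrix.sum_mulVec]
      refine hsmul _ (neg_mem ((Valuation.mem_integer_iff _ _).2 (by rw [map_inv₀, hc0, inv_one]))) _ (Submodule.sum_mem _ fun i _ => ?_)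
      rw [Matrix.smul_mulVec, Matrix.mulVec_mulVec, ← pow_add, Polynomial.coeff_divX]
      exact hsmul _ (hint _) _ (hpow _)
    · rw [LinearMap.coe_restrictScalars, Matrix.toLin'_apply, Matrix.mulVec_mulVec, hγB, Matrix.one_mulVec]
  exact le_antisymm hle hge

/-- **THE `ψ_{n−1}` COUNT, CONJUNCT-FREE** (deep `γ`): `#{gK ∈ Fix_γ : rank(red(g⁻¹γg) − 1) = n − 1} = #{Λ = Λ(g) : ∃ w, Λ = ⊕_{j<n} 𝒪·γ^j w}`.
[cite: Kottwitz1986, §3] [cite: Rogawski1990, §4.9 p. 54] -/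
theorem ncard_fixedBy_glInt_rank_eq_ncard_free' (γ : GL (Fin n) F)
    (hγ : ∀ m : ℕ, valuation F (((γ : Matrix (Fin n) (Fin n) F).charpoly - (Polynomial.X - 1) ^ n).coeff m) < 1) :
    {q : GL (Fin n) F ⧸ glInt n F | q ∈ MulAction.fixedBy (GL (Fin n) F ⧸ glInt n F) γ ∧
        (redMat (((q.out)⁻¹ * γ * q.out : GL (Fin n) F) : Matrix (Fin n) (Fin n) F) - 1).rank = n - 1}.ncard =
      {Λ : Submodule 𝒪[F] (Fin n → F) |
        (∃ g : GL (Fin n) F, Λ = Submodule.span 𝒪[F] (Set.range ((g : Matrix (Fin n) (Fin n) F))ᵀ)) ∧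
          ∃ w : Fin n → F, Λ = Submodule.span 𝒪[F] (Set.range fun j : Fin n => ((γ : Matrix (Fin n) (Fin n) F) ^ (j : ℕ)) *ᵥ w)}.ncard := by
  rw [ncard_fixedBy_glInt_rank_eq_ncard_free γ hγ]
  congr 1
  ext Λ
  simp only [Set.mem_setOf_eq]
  constructor
  · rintro ⟨h1, -, h3⟩
    exact ⟨h1, h3⟩
  · rintro ⟨h1, w, rfl⟩
    exact ⟨h1, map_span_range_pow_mulVec_eq_self_of_deep γ hγ w, w, rfl⟩

/-- **THE `ψ_{n−1}` COUNT INSIDE `U(J)`, CONJUNCT-FREE** (deep `γ ∈ U`): `#{uK_U ∈ Fix_γ(U ⧸ K_U) : rank(red(u⁻¹γu) − 1) = n − 1} =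
#{Λ = Λ(u), u ∈ U : ∃ w, Λ = ⊕_{j<n} 𝒪·γ^j w}` — the LEFT set of O8a-4 «COUNT TRANSPORT» (F0P3b-p01). [cite: Kottwitz1986, §3] [cite: Rogawski1990, §4.9 Prop. 4.9.1 (b) p. 55] -/
theorem ncard_fixedBy_unitary_rank_eq_ncard_free' {E : Type*} [Field E] [ValuativeRel E] {n : ℕ} (σ : E →+* E) (J : GL (Fin n) E)
    (γ : ↥(unitaryGroupOfForm σ (J : Matrix (Fin n) (Fin n) E)))
    (hγ : ∀ m : ℕ, valuation E (((((γ : GL (Fin n) E)) : Matrix (Fin n) (Fin n) E).charpoly - (Polynomial.X - 1) ^ n).coeff m) < 1) :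
    {q : ↥(unitaryGroupOfForm σ (J : Matrix (Fin n) (Fin n) E)) ⧸ (glInt n E).subgroupOf (unitaryGroupOfForm σ (J : Matrix (Fin n) (Fin n) E)) |
        q ∈ MulAction.fixedBy (↥(unitaryGroupOfForm σ (J : Matrix (Fin n) (Fin n) E)) ⧸ (glInt n E).subgroupOf (unitaryGroupOfForm σ (J : Matrix (Fin n) (Fin n) E))) γ ∧
          (redMat ((((q.out)⁻¹ * γ * q.out : ↥(unitaryGroupOfForm σ (J : Matrix (Fin n) (Fin n) E))) : GL (Fin n) E) : Matrix (Fin n) (Fin n) E) - 1).rank = n - 1}.ncard =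
      {Λ : Submodule 𝒪[E] (Fin n → E) |
        (∃ u ∈ unitaryGroupOfForm σ (J : Matrix (Fin n) (Fin n) E), Λ = Submodule.span 𝒪[E] (Set.range ((u : Matrix (Fin n) (Fin n) E))ᵀ)) ∧
          ∃ w : Fin n → E, Λ = Submodule.span 𝒪[E] (Set.range fun j : Fin n => ((((γ : GL (Fin n) E)) : Matrix (Fin n) (Fin n) E) ^ (j : ℕ)) *ᵥ w)}.ncard := by
  rw [ncard_fixedBy_unitary_rank_eq_ncard_free σ J γ hγ]
  congr 1
  ext Λ
  simp only [Set.mem_setOf_eq]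
  constructor
  · rintro ⟨h1, -, h3⟩
    exact ⟨h1, h3⟩
  · rintro ⟨h1, w, rfl⟩
    exact ⟨h1, map_span_range_pow_mulVec_eq_self_of_deep (γ : GL (Fin n) E) hγ w, w, rfl⟩

end Stable

end Literature.NumberTheory.Automorphic

end
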